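import Literature.AnabelianGeometry.EtaleTheta.ConstantMultipleRigidityUniqueProofs
import Literature.AnabelianGeometry.EtaleTheta.Discharge.Sec1OrbitGenerator
import Literature.AnabelianGeometry.EtaleTheta.Discharge.Sec1SingleClassValueLaw
import Literature.AnabelianGeometry.EtaleTheta.ConstantMultipleRigidityEquivarianceProofs
import HarnessLib

/-!
# [EtTh] Thm. 1.10 (i) «determines this collection of classes up to multiplication by ±1» — at the
# MODEL, from the evaluation dictionary (assembly of the K2 rows (T), G-L2t6g4-1, G-L2t6g4-2, G-L2t6g4-3)

S. Mochizuki, *The étale theta function and its Frobenioid-theoretic manifestations*, Publ. RIMS **45**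
(2009), §1, Thm. 1.10 (i), PRIMS PDF pp. 29–30 (printed 255–256): «The isomorphism γ preserves the
property that `η̈^{Θ,ℤ}` be of standard type, a property that determines this collection of classes
up to multiplication by `±1`» [cite: MochizukiEtTh2009, Thm 1.10 (i) p.30]. Layer L2 of the abc-iut
cell, seat abc-iut-L2-t6 (gen 4). PROOF-ONLY assembly (no `def`, no named fact) of
* abc-iut-w5-d140's `MuTwoSetting.thm110iUnique_of_signedFormula` (K2 row r8, p418589): the typed
  `Thm110iUnique` from (V2′) `Thm110UnitClassEquivariance`, (V1″) `StandardValuesFormulaSigned` and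
  (b₂) `StandardValuesInvSymm`;
* this seat's `standardValuesFormulaSigned_of_dictionary` / `standardValuesInvSymm_of_dictionary`
  (p418439): V1″ and (b₂) from the evaluation DICTIONARY at the points over `τ`, `τ⁻¹`;
* this seat's `exists_orbit_generator` (p419021): the generator of `Π^tp_Ẋ/Π^tp_Ÿ ≅ ℤ` from
  «`toZ` of a lift of `ε_Z` is odd» (⇐ the printed characterisation of `ε_μ`,
  `odd_toZ_of_isAdmissibleEpsZ`).

RESULT: `thm110iUnique_of_dictionary` — **`Thm110iUnique hC hZ E S` holds at the model GIVEN** (V2′)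
(the unit Kummer classes are fixed by the orbit group; K2 intermediate statement, abc-iut-w5-d234's row)
**and the four geometric/cohomological sentences of the printed proof** as named binders: a lift `σ_Z`
of `ε_Z` of odd `toZ` (GAP G-L2t6g4-3, discharged modulo P-C8), points `τ_a`, `τ'_a` of `Ÿ` over
`τ`, `τ⁻¹` with coordinates `(s q̈)^a·√−1^{±1}` and NATURALITY of evaluation along the translates
(G-L2t6g4-1), and the single-class value law `c·Θ̈(Ü(·))` of Prop. 1.4 (iii) at those points
(G-L2t6g4-2). `thm110iUnique_of_dictionary_of_epsMu` takes instead the printed characterisation of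
`ε_μ` («acts trivially on the set of irreducible components of the special fiber», Def. 1.7 p. 27:
`toZ` of a lift of `ε_μ` is even). **`thm110iUnique_of_referenceClass`** consumes abc-iut-w5-d140's
`EtaleThetaData.exists_val_family` (p419616, GAP G-L2t6g4-2 reduced) BY NAME: the value binders are
replaced by the value law of ONE reference theta class `κ₀` at all non-cuspidal points — so the
hypotheses are (V2′), the reference-class law, the points over `τ^{±1}` with naturality (G-L2t6g4-1),
and the parity of `ε_Z`; `…_of_prop15ii` further discharges (V2′) by t1's named fact `Prop15ii`
(abc-iut-w5-d234's `thm110UnitClassEquivariance_of_prop15ii`, p418922).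
HONEST FRAMING: conditional on the named binders (interface-invisible printed sentences, GAP rows of
the cell) and on (V2′); typed ≠ proved for [EtTh]; nothing here bears on the disputed [IUTchIII]
Cor. 3.12.
-/

noncomputable section

namespace Literature.AnabelianGeometry.EtaleTheta

open Literature.AnabelianGeometry.SemiGraphs

namespace MuTwoSetting

variable {p : ℕ} [Fact p.Prime] {M : MuTwoSetting p}

/-- **[EtTh] Thm. 1.10 (i), uniqueness up to `±1`, AT THE MODEL from the evaluation dictionary**:
for an admissible `ε_Z` with a lift `σ_Z` of odd `toZ`, an étale theta datum `E` and standard data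
`S` (`√−1`, `τ`, `τ⁻¹`), GIVEN (V2′) and, for the generator `σ₁` of `Π^tp_Ẋ/Π^tp_Ÿ` produced by
`exists_orbit_generator`, points `τ_a` / `τ'_a` over `τ` / `τ⁻¹` with coordinates
`(s q̈)^a √−1` / `(s q̈)^a (√−1)⁻¹` (`s = ±1`), naturality of evaluation along `conj(σ₁^a)`, and the
single-class values `c·Θ̈(Ü(·))` of `η̈^Θ` there — THEN `η̈^{Θ,ℤ}` and `(u·η̈)^{Θ,ℤ}` (`u ∈ O^×_{K̈}`)
both of standard type forces `u = ±1`. (The binders are quantified AFTER the generator: they are asked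
only for the `σ₁` the interface produces.) [cite: MochizukiEtTh2009, Thm 1.10 (i) p.30] -/
theorem thm110iUnique_of_dictionary (hC : M.toThetaSetting.Compat) {εZ : M.GtpC}
    (hZ : M.IsAdmissibleEpsZ εZ) (E : M.toThetaSetting.EtaleThetaData)
    (S : M.StandardData E.toKummerData)
    (hV2 : Thm110UnitClassEquivariance hC εZ E.toKummerData)
    {σZ : M.PiTemp} (hσZ : M.inclX σZ = εZ) (hodd : Odd (Multiplicative.toAdd (M.toZ σZ)))
    {s : PadicAlgCl p} (hs : s = 1 ∨ s = -1)
    (hdict : haveI := hC.GtpYdd_normal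
      ∀ σ₁ : M.PiTemp, M.inclX σ₁ ∈ M.dotX εZ → Multiplicative.toAdd (M.toZ σ₁) = 1 →
      ∃ (τ_ τ'_ : ℤ → ThetaSetting.NonCuspidalPoint E.toKummerData) (c : PadicAlgCl p)
        (val val' : ℤ → (↥M.Kdd)ˣ),
        (∀ a : ℤ, S.tau.evalAt (ContH1.res M.toTheta M.toThetaSetting.DeltaTheta S.tau.Dpt_le
            (ContH1.conj M.toTheta M.toThetaSetting.DeltaTheta (σ₁ ^ a) E.etaDd)) =
          (τ_ a).evalAt (ContH1.res M.toTheta M.toThetaSetting.DeltaTheta (τ_ a).Dpt_le E.etaDd)) ∧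
        (∀ a : ℤ, S.tauInv.evalAt (ContH1.res M.toTheta M.toThetaSetting.DeltaTheta S.tauInv.Dpt_le
            (ContH1.conj M.toTheta M.toThetaSetting.DeltaTheta (σ₁ ^ a) E.etaDd)) =
          (τ'_ a).evalAt (ContH1.res M.toTheta M.toThetaSetting.DeltaTheta (τ'_ a).Dpt_le E.etaDd)) ∧
        (∀ a : ℤ, (((τ_ a).coord : M.Kdd) : PadicAlgCl p) =
          (s * M.toThetaSetting.qdd) ^ a * S.sqrtNegOne) ∧
        (∀ a : ℤ, (((τ'_ a).coord : M.Kdd) : PadicAlgCl p) =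
          (s * M.toThetaSetting.qdd) ^ a * S.sqrtNegOne⁻¹) ∧
        (∀ a : ℤ, ((val a : M.Kdd) : PadicAlgCl p) =
          c * thetaDdot M.toThetaSetting.qdd (((τ_ a).coord : M.Kdd) : PadicAlgCl p)) ∧
        (∀ a : ℤ, ((val' a : M.Kdd) : PadicAlgCl p) =
          c * thetaDdot M.toThetaSetting.qdd (((τ'_ a).coord : M.Kdd) : PadicAlgCl p)) ∧
        (∀ a : ℤ, (τ_ a).evalAt
            (ContH1.res M.toTheta M.toThetaSetting.DeltaTheta (τ_ a).Dpt_le E.etaDd) =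
          E.toKddHat (val a)) ∧
        (∀ a : ℤ, (τ'_ a).evalAt
            (ContH1.res M.toTheta M.toThetaSetting.DeltaTheta (τ'_ a).Dpt_le E.etaDd) =
          E.toKddHat (val' a))) :
    Thm110iUnique hC hZ E S := by
  haveI := hC.GtpYdd_normal
  obtain ⟨σ₁, hσ₁X, hσ₁Z, hgen⟩ := exists_orbit_generator hσZ hodd
  obtain ⟨τ_, τ'_, c, val, val', hnat, hnat', hcoord, hcoord', hval, hval', heval, heval'⟩ :=
    hdict σ₁ hσ₁X hσ₁Z
  exact thm110iUnique_of_signedFormula hC hZ E S hV2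
    (standardValuesFormulaSigned_of_dictionary hC εZ S E.etaDd hσ₁X hgen τ_ hnat hs hcoord val hval
      heval)
    (standardValuesInvSymm_of_dictionary hC εZ S E.etaDd hσ₁X hgen τ_ τ'_ hnat hnat' hs hcoord hcoord'
      val val' hval hval' heval heval')

/-- **The same from the printed characterisation of `ε_μ`** (Def. 1.7, p. 27: «the unique nontrivial
element of `Gal(Ẍ/X)` that acts trivially on the set of irreducible components of the special fiber» —
read: `toZ` of a lift `μ̃` of `ε_μ` is EVEN, d3's census item P-C8): then every lift of the admissible
`ε_Z` has odd `toZ` (`odd_toZ_of_isAdmissibleEpsZ`) and `thm110iUnique_of_dictionary` applies.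
[cite: MochizukiEtTh2009, Thm 1.10 (i) p.30] -/
theorem thm110iUnique_of_dictionary_of_epsMu (hC : M.toThetaSetting.Compat) {εZ : M.GtpC}
    (hZ : M.IsAdmissibleEpsZ εZ) (E : M.toThetaSetting.EtaleThetaData)
    (S : M.StandardData E.toKummerData)
    (hV2 : Thm110UnitClassEquivariance hC εZ E.toKummerData)
    {σZ : M.PiTemp} (hσZ : M.inclX σZ = εZ)
    {μ : M.PiTemp} (hμX : M.inclX μ = M.epsMu) (hμ : Even (Multiplicative.toAdd (M.toZ μ)))
    {s : PadicAlgCl p} (hs : s = 1 ∨ s = -1)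
    (hdict : haveI := hC.GtpYdd_normal
      ∀ σ₁ : M.PiTemp, M.inclX σ₁ ∈ M.dotX εZ → Multiplicative.toAdd (M.toZ σ₁) = 1 →
      ∃ (τ_ τ'_ : ℤ → ThetaSetting.NonCuspidalPoint E.toKummerData) (c : PadicAlgCl p)
        (val val' : ℤ → (↥M.Kdd)ˣ),
        (∀ a : ℤ, S.tau.evalAt (ContH1.res M.toTheta M.toThetaSetting.DeltaTheta S.tau.Dpt_le
            (ContH1.conj M.toTheta M.toThetaSetting.DeltaTheta (σ₁ ^ a) E.etaDd)) =
          (τ_ a).evalAt (ContH1.res M.toTheta M.toThetaSetting.DeltaTheta (τ_ a).Dpt_le E.etaDd)) ∧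
        (∀ a : ℤ, S.tauInv.evalAt (ContH1.res M.toTheta M.toThetaSetting.DeltaTheta S.tauInv.Dpt_le
            (ContH1.conj M.toTheta M.toThetaSetting.DeltaTheta (σ₁ ^ a) E.etaDd)) =
          (τ'_ a).evalAt (ContH1.res M.toTheta M.toThetaSetting.DeltaTheta (τ'_ a).Dpt_le E.etaDd)) ∧
        (∀ a : ℤ, (((τ_ a).coord : M.Kdd) : PadicAlgCl p) =
          (s * M.toThetaSetting.qdd) ^ a * S.sqrtNegOne) ∧
        (∀ a : ℤ, (((τ'_ a).coord : M.Kdd) : PadicAlgCl p) =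
          (s * M.toThetaSetting.qdd) ^ a * S.sqrtNegOne⁻¹) ∧
        (∀ a : ℤ, ((val a : M.Kdd) : PadicAlgCl p) =
          c * thetaDdot M.toThetaSetting.qdd (((τ_ a).coord : M.Kdd) : PadicAlgCl p)) ∧
        (∀ a : ℤ, ((val' a : M.Kdd) : PadicAlgCl p) =
          c * thetaDdot M.toThetaSetting.qdd (((τ'_ a).coord : M.Kdd) : PadicAlgCl p)) ∧
        (∀ a : ℤ, (τ_ a).evalAt
            (ContH1.res M.toTheta M.toThetaSetting.DeltaTheta (τ_ a).Dpt_le E.etaDd) =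
          E.toKddHat (val a)) ∧
        (∀ a : ℤ, (τ'_ a).evalAt
            (ContH1.res M.toTheta M.toThetaSetting.DeltaTheta (τ'_ a).Dpt_le E.etaDd) =
          E.toKddHat (val' a))) :
    Thm110iUnique hC hZ E S :=
  thm110iUnique_of_dictionary hC hZ E S hV2 hσZ (M.odd_toZ_of_isAdmissibleEpsZ hZ hσZ hμX hμ) hs hdict

/-- **Thm. 1.10 (i) uniqueness at the model from the REFERENCE-CLASS LAW** (abc-iut-w5-d140's
`exists_val_families_of_lawOn`, p419616/p419834): the value binders of `thm110iUnique_of_dictionary`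
follow from the exact value law of one reference theta class `κ₀` («the Kummer class of `Θ̈` evaluates
at `y` to `Θ̈(Ü(y))`», Prop. 1.4 (iii) p. 22) ON THE POINTS USED (the junk-robust form: a law over all
abstract `NonCuspidalPoint`s would be unsatisfiable at any model), with ONE constant `c` for the two
families over `τ` and `τ⁻¹` (as `standardValuesInvSymm_of_dictionary` requires). Remaining binders:
(V2′), and for the generator `σ₁`: the points over `τ^{±1}` with naturality of evaluation (G-L2t6g4-1)
and the reference-class law at them (G-L2t6g4-2 residual), plus the parity of a lift of `ε_Z`.
[cite: MochizukiEtTh2009, Thm 1.10 (i) p.30] -/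
theorem thm110iUnique_of_referenceClass (hC : M.toThetaSetting.Compat) {εZ : M.GtpC}
    (hZ : M.IsAdmissibleEpsZ εZ) (E : M.toThetaSetting.EtaleThetaData)
    (S : M.StandardData E.toKummerData)
    (hV2 : Thm110UnitClassEquivariance hC εZ E.toKummerData)
    {κ₀ : M.toThetaSetting.H1 M.toThetaSetting.GtpYdd} (hκ₀mem : κ₀ ∈ E.thetaClasses)
    {σZ : M.PiTemp} (hσZ : M.inclX σZ = εZ) (hodd : Odd (Multiplicative.toAdd (M.toZ σZ)))
    {s : PadicAlgCl p} (hs : s = 1 ∨ s = -1)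
    (hpts : haveI := hC.GtpYdd_normal
      ∀ σ₁ : M.PiTemp, M.inclX σ₁ ∈ M.dotX εZ → Multiplicative.toAdd (M.toZ σ₁) = 1 →
      ∃ (τ_ τ'_ : ℤ → ThetaSetting.NonCuspidalPoint E.toKummerData),
        (∀ a : ℤ, S.tau.evalAt (ContH1.res M.toTheta M.toThetaSetting.DeltaTheta S.tau.Dpt_le
            (ContH1.conj M.toTheta M.toThetaSetting.DeltaTheta (σ₁ ^ a) E.etaDd)) =
          (τ_ a).evalAt (ContH1.res M.toTheta M.toThetaSetting.DeltaTheta (τ_ a).Dpt_le E.etaDd)) ∧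
        (∀ a : ℤ, S.tauInv.evalAt (ContH1.res M.toTheta M.toThetaSetting.DeltaTheta S.tauInv.Dpt_le
            (ContH1.conj M.toTheta M.toThetaSetting.DeltaTheta (σ₁ ^ a) E.etaDd)) =
          (τ'_ a).evalAt (ContH1.res M.toTheta M.toThetaSetting.DeltaTheta (τ'_ a).Dpt_le E.etaDd)) ∧
        (∀ a : ℤ, (((τ_ a).coord : M.Kdd) : PadicAlgCl p) =
          (s * M.toThetaSetting.qdd) ^ a * S.sqrtNegOne) ∧
        (∀ a : ℤ, (((τ'_ a).coord : M.Kdd) : PadicAlgCl p) =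
          (s * M.toThetaSetting.qdd) ^ a * S.sqrtNegOne⁻¹) ∧
        (∀ a : ℤ, ∃ v : (↥M.Kdd)ˣ, ((v : M.Kdd) : PadicAlgCl p) =
            thetaDdot M.toThetaSetting.qdd (((τ_ a).coord : M.Kdd) : PadicAlgCl p) ∧
          (τ_ a).evalAt (ContH1.res M.toTheta M.toThetaSetting.DeltaTheta (τ_ a).Dpt_le κ₀) =
            E.toKddHat v) ∧
        (∀ a : ℤ, ∃ v : (↥M.Kdd)ˣ, ((v : M.Kdd) : PadicAlgCl p) =
            thetaDdot M.toThetaSetting.qdd (((τ'_ a).coord : M.Kdd) : PadicAlgCl p) ∧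
          (τ'_ a).evalAt (ContH1.res M.toTheta M.toThetaSetting.DeltaTheta (τ'_ a).Dpt_le κ₀) =
            E.toKddHat v)) :
    Thm110iUnique hC hZ E S := by
  haveI := hC.GtpYdd_normal
  have hη : E.etaDd ∈ E.thetaClasses := ⟨1, one_mem _, (one_mul _).symm⟩
  refine thm110iUnique_of_dictionary hC hZ E S hV2 hσZ hodd hs ?_
  intro σ₁ hσ₁X hσ₁Z
  obtain ⟨τ_, τ'_, hnat, hnat', hcoord, hcoord', hlaw, hlaw'⟩ := hpts σ₁ hσ₁X hσ₁Z
  obtain ⟨c, val, val', hval, hval', heval, heval', -⟩ :=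
    E.exists_val_families_of_lawOn hκ₀mem τ_ τ'_ hlaw hlaw' hη
  exact ⟨τ_, τ'_, c, val, val', hnat, hnat', hcoord, hcoord', hval, hval', heval, heval'⟩

/-- **The same with (V2′) discharged by [EtTh] Prop. 1.5 (ii)** (abc-iut-w5-d234's
`thm110UnitClassEquivariance_of_prop15ii`, p418922: the unit Kummer classes `infl κ(u)` are fixed by
the orbit group because `F̈² = κ(K̈^×)`, t1's named fact `Prop15ii`): the cohomological hypothesis of
the junction is then `Prop15ii` ALONE. [cite: MochizukiEtTh2009, Thm 1.10 (i) p.30] -/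
theorem thm110iUnique_of_referenceClass_of_prop15ii (hC : M.toThetaSetting.Compat) {εZ : M.GtpC}
    (hZ : M.IsAdmissibleEpsZ εZ) (E : M.toThetaSetting.EtaleThetaData)
    (S : M.StandardData E.toKummerData) (h15ii : ThetaSetting.Prop15ii E.toKummerData hC)
    {κ₀ : M.toThetaSetting.H1 M.toThetaSetting.GtpYdd} (hκ₀mem : κ₀ ∈ E.thetaClasses)
    {σZ : M.PiTemp} (hσZ : M.inclX σZ = εZ) (hodd : Odd (Multiplicative.toAdd (M.toZ σZ)))
    {s : PadicAlgCl p} (hs : s = 1 ∨ s = -1)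
    (hpts : haveI := hC.GtpYdd_normal
      ∀ σ₁ : M.PiTemp, M.inclX σ₁ ∈ M.dotX εZ → Multiplicative.toAdd (M.toZ σ₁) = 1 →
      ∃ (τ_ τ'_ : ℤ → ThetaSetting.NonCuspidalPoint E.toKummerData),
        (∀ a : ℤ, S.tau.evalAt (ContH1.res M.toTheta M.toThetaSetting.DeltaTheta S.tau.Dpt_le
            (ContH1.conj M.toTheta M.toThetaSetting.DeltaTheta (σ₁ ^ a) E.etaDd)) =
          (τ_ a).evalAt (ContH1.res M.toTheta M.toThetaSetting.DeltaTheta (τ_ a).Dpt_le E.etaDd)) ∧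
        (∀ a : ℤ, S.tauInv.evalAt (ContH1.res M.toTheta M.toThetaSetting.DeltaTheta S.tauInv.Dpt_le
            (ContH1.conj M.toTheta M.toThetaSetting.DeltaTheta (σ₁ ^ a) E.etaDd)) =
          (τ'_ a).evalAt (ContH1.res M.toTheta M.toThetaSetting.DeltaTheta (τ'_ a).Dpt_le E.etaDd)) ∧
        (∀ a : ℤ, (((τ_ a).coord : M.Kdd) : PadicAlgCl p) =
          (s * M.toThetaSetting.qdd) ^ a * S.sqrtNegOne) ∧
        (∀ a : ℤ, (((τ'_ a).coord : M.Kdd) : PadicAlgCl p) =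
          (s * M.toThetaSetting.qdd) ^ a * S.sqrtNegOne⁻¹) ∧
        (∀ a : ℤ, ∃ v : (↥M.Kdd)ˣ, ((v : M.Kdd) : PadicAlgCl p) =
            thetaDdot M.toThetaSetting.qdd (((τ_ a).coord : M.Kdd) : PadicAlgCl p) ∧
          (τ_ a).evalAt (ContH1.res M.toTheta M.toThetaSetting.DeltaTheta (τ_ a).Dpt_le κ₀) =
            E.toKddHat v) ∧
        (∀ a : ℤ, ∃ v : (↥M.Kdd)ˣ, ((v : M.Kdd) : PadicAlgCl p) =
            thetaDdot M.toThetaSetting.qdd (((τ'_ a).coord : M.Kdd) : PadicAlgCl p) ∧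
          (τ'_ a).evalAt (ContH1.res M.toTheta M.toThetaSetting.DeltaTheta (τ'_ a).Dpt_le κ₀) =
            E.toKddHat v)) :
    Thm110iUnique hC hZ E S :=
  thm110iUnique_of_referenceClass hC hZ E S (thm110UnitClassEquivariance_of_prop15ii hC εZ h15ii)
    hκ₀mem hσZ hodd hs hpts

end MuTwoSetting

end Literature.AnabelianGeometry.EtaleTheta

end
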